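import Summits.AtomisticToContinuum.BoseEinsteinCondensation.Theses.BECSubharmonicContinuation
import Literature.Barriers.AtomisticToContinuum.KineticGapLengthScalesFreeGas
import Literature.MathematicalPhysics.QuantumManyBody.PeriodicBoseGasUpperBoundProofs
import HarnessLib

/-!
# Route BECSubharmonicContinuation — support `FreeGasCase` (stmt-AtomisticToContinuum-9005)

The degenerate case `a = 0` of the periodic-BEC body: for an admissible pair potential `v`
(measurable, finite range `R₀`) with `scatteringLength v = 0`, every periodic `δ_N`-near-minimiser
on the thermodynamic torus `L_N = (N/ρ)^{1/3}` has at least `N/2` particles in the constant mode,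
for all `N ≥ 2` with `2R₀ < L_N`, with the slack `δ_N = N/(2 C L_N²)`.

Proof: by the proved LSSY upper bound (`LSSY2005_upperBound_periodic_holds`, whose `a = 0` case
rests on LSSY App. C: `a = 0 ⇒ v = 0` a.e.) `E₀^per(v, N, L) = 0` for `N ≥ 2`, `2R₀ < L`; so a
`δ`-near-minimiser has total energy `≤ δ`, and the torus Poincaré inequality on every slice
(LSSY Lemma 4.1, packaged as `natCast_le_condensateOccupation_add`:
`N ≤ ⟨Ψ, n₀Ψ⟩ + C L² ⟨Ψ, HΨ⟩`) gives `n₀ ≥ N - C L² δ = N/2`.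

## References

* [LSSY2005] E. H. Lieb, R. Seiringer, J. P. Solovej, J. Yngvason, *The Mathematics of the Bose
  Gas and its Condensation* (2005), Thm. 2.2 (2.14), App. C, Lemma 4.1, Ch. 5 (5.15)–(5.17).
-/

noncomputable section

namespace Summit.AtomisticToContinuum.BoseEinsteinCondensation.Theorems

open Literature.MathematicalPhysics.QuantumManyBody.BoseGas
open Literature.Barriers.AtomisticToContinuum.BoseGas
open _root_.MeasureTheory _root_.Filter _root_.Topology
open scoped ENNReal NNReal

/-- **Zero scattering length means zero periodic ground-state energy.** For measurable `v ≥ 0` of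
finite range with `a = 0` there is `R₀` (a range of `v`) such that `E₀^per(v, N, L) = 0` for all
`N ≥ 2` and all boxes with `2R₀ < L` — the `a = 0` case of the proved LSSY upper bound
`E₀^per ≤ 4πρ₁a(1 + C a/b)N`. [cite: LSSY2005, Thm. 2.2 (2.14) and App. C] -/
theorem periodicGroundStateEnergy_eq_zero_of_scatteringLength_eq_zero {v : ℝ → ℝ≥0∞}
    (hv : IsRepulsiveFiniteRange v) (ha : scatteringLength v = 0) :
    ∃ R₀ : ℝ, ∀ (N : ℕ) (L : ℝ), 2 ≤ N → 0 < L → 2 * R₀ < L →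
      periodicGroundStateEnergy v N L = 0 := by
  obtain ⟨hmeas, R₀, hR⟩ := hv
  obtain ⟨C, c, _, hc, h⟩ :=
    LSSY2005_upperBound_periodic_holds v R₀ hmeas hR (by rw [ha]; exact ENNReal.zero_ne_top)
  refine ⟨R₀, fun N L hN hL hRL => ?_⟩
  have key := h N L hN hL hRL
  simp only [ha, ENNReal.toReal_zero, zero_div, mul_zero, zero_mul, ENNReal.ofReal_zero,
    nonpos_iff_eq_zero] at key
  exact key hc.le

/-- **Support `FreeGasCase` (stmt-AtomisticToContinuum-9005) of route BECSubharmonicContinuation,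
proved**: for admissible `v` with `scatteringLength v = 0` the periodic-BEC body holds with
`ρ₀ = 1`, `c = 1/2` and slack `δ_N = N/(2 C L_N²)` for all `N ≥ 2` with `2R₀ < L_N`
(`E₀^per = 0` by `periodicGroundStateEnergy_eq_zero_of_scatteringLength_eq_zero`, then
`N ≤ n₀ + C L² ⟨Ψ, HΨ⟩` by the torus Poincaré inequality on every slice).
[cite: LSSY2005, App. C, Lemma 4.1, Ch. 5 (5.15)–(5.17)] -/
theorem freeGasCase_proof :
    Summit.AtomisticToContinuum.BoseEinsteinCondensation.Theses.BECSubharmonicContinuation.FreeGasCase := by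
  unfold Summit.AtomisticToContinuum.BoseEinsteinCondensation.Theses.BECSubharmonicContinuation.FreeGasCase
  intro v hv ha
  obtain ⟨R₀, hE⟩ := periodicGroundStateEnergy_eq_zero_of_scatteringLength_eq_zero hv ha
  obtain ⟨C, hC, h⟩ := natCast_le_condensateOccupation_add
  refine ⟨1, one_pos, fun ρ hρ _ => ⟨1 / 2, by norm_num, ?_⟩⟩
  filter_upwards [eventually_gt_atTop 1,
    (tendsto_sideLength_atTop hρ).eventually_gt_atTop (2 * R₀)] with N hN hNR
  have hN0 : 0 < N := lt_trans zero_lt_one hN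
  have hN2 : 2 ≤ N := hN
  have hL : 0 < sideLength ρ N := sideLength_pos_of_pos hρ hN0
  have hNpos : (0 : ℝ) < N := Nat.cast_pos.2 hN0
  refine ⟨ENNReal.ofReal (N / (2 * C * sideLength ρ N ^ 2)), ?_, fun Ψ hΨ => ?_⟩
  · rw [ENNReal.ofReal_pos]
    positivity
  · rw [hE N (sideLength ρ N) hN2 hL hNR, zero_add] at hΨ
    have key := h N (sideLength ρ N) hN hL v Ψ
    have hwin : ENNReal.ofReal (C * sideLength ρ N ^ 2) * periodicEnergy v Ψ ≤
        ENNReal.ofReal (N / 2) := by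
      calc ENNReal.ofReal (C * sideLength ρ N ^ 2) * periodicEnergy v Ψ
          ≤ ENNReal.ofReal (C * sideLength ρ N ^ 2) *
              ENNReal.ofReal (N / (2 * C * sideLength ρ N ^ 2)) := by gcongr
        _ = ENNReal.ofReal (N / 2) := by
            rw [← ENNReal.ofReal_mul (by positivity)]
            congr 1
            field_simp
    have hsplit : (N : ℝ≥0∞) = ENNReal.ofReal (1 / 2 * N) + ENNReal.ofReal (N / 2) := by
      rw [← ENNReal.ofReal_add (by positivity) (by positivity), ← ENNReal.ofReal_natCast]
      congr 1
      ring
    have h2 := key.trans (add_le_add le_rfl hwin)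
    rw [hsplit] at h2
    exact (ENNReal.add_le_add_iff_right ENNReal.ofReal_ne_top).1 h2

end Summit.AtomisticToContinuum.BoseEinsteinCondensation.Theorems

end
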